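import Literature.Barriers.CriticalPhenomena.SupercriticalSAWSpaceFillingWindowRate
import HarnessLib

/-!
# Barrier mechanism, nineteenth audit (part B): the blocked near-critical window improved from
# `δ^{1/6}` to `δ^{1/4}` — the avoided ball is a hole of `≍ (r/δ)²` sites, not `≍ r/δ`

Barrier catalogue `Literature/Barriers/CriticalPhenomena/` (D-0021); second companion of the
nineteenth audit (2026-08-16, refuter, "barrier-audit" gen 19) of the mechanism file `…Proofs` of
`SupercriticalSAWSpaceFilling` = Theorem 1 of H. Duminil-Copin, G. Kozma, A. Yadin,
*Supercritical self-avoiding walks are space-filling*, Ann. IHP Probab. Stat. 50 (2014) 315–326,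
arXiv:1110.3074 (PROVED in the tree). Part A (`…VolumeWindow`) decided the lower edge of the
window axis; this part sharpens the upper, BLOCKED edge.

## What the audit found

The fifteenth audit (`…WindowRate`) proved that every fugacity window `w(δ) ≥ δ^θ`, `θ < 1/6`, is
blocked, and recorded that "improving `1/6` needs either a better span/length trade-off for
squared walks … or a Peierls sum whose per-box gain is used in the rate". Re-reading the proof
of Theorem 1 at page level (arXiv p. 7: "Consider a connected set `S` of cardinality `s` at
distance larger than `6m` of `γ_δ` … there must exist a connected family of at least `s/(2m+1)²`
boxes … `≤ C(x,m,Ω) δ⁻² 2^{-s/(2m+1)²}`") shows a cheaper lever: the printed estimate is in the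
SITE-CARDINALITY `s` of the hole, and `…WindowRate` feeds the tree's effective Theorem 6
(`DKY2014_thm6_disk_effective`, also in `s`) the digital SEGMENT of `⌊r/(4δ)⌋ + 1 ≍ r/δ` sites of
`hasLargeHole_of_forall_notMem_ball` (`…Refutation`), whereas a ball `B(z, r)` free of visited
mesh points contains — under the same side conditions `8δ ≤ r`, `ξδ ≤ r/2` — the digital SQUARE
of `(⌊r/(6δ)⌋ + 1)² ≍ (r/δ)²` sites `[z/δ] + (i, j)` in one component of `𝔻_δ ∖ Γ_δ^ξ`
(`hasLargeHole_sq_of_forall_notMem_ball`: rows joined through columns, all mesh points within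
`r/3 + δ ≤ 11r/24 < r/2` of `z`, hence in `𝔻_δ` and at graph distance `≥ ξ` from the walk). Along
`x(δ) = x_c + δ^θ` with the certified scales `m ≤ C δ^{-2θ}` of `exists_certifiedScale_le`, the
pointwise bound `schedule_pointwise` of `…WindowRate` at the (`δ`-dependent) hole size `r²/δ`
reads `exp(2 log δ⁻¹ + 200A δ^{-2θ} - (r²/(1600A²)) δ^{4θ-2})`, which tends to `0` iff `6θ < 2`;
the binding constraint is now the mesh threshold of the tile construction,
`δ < (6000 A² δ^{-4θ})⁻¹` eventually iff `4θ < 1`. Hence: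

* `isSpaceFillingLaws_of_Zbox_schedule_sq`, `not_sawScalingLimitAlong_of_Zbox_schedule_sq`,
  `not_windowRobustSAWScalingLimit_of_Zbox_schedule_sq` — the effective schedule theorems of
  `…StepsNarrow` with the Peierls hypothesis at hole size `(r/δ)²`;
* `schedule_hypotheses_sq` — the schedule `x_c + δ^θ`, `0 < θ < 1/4`, meets them;
* `isSpaceFillingLaws_rpow_schedule_quarter`, `not_sawScalingLimitAlong_rpow_quarter`,
  `not_windowRobustSAWScalingLimit_of_rpow_le_quarter`, `not_windowRobustSAWScalingLimit_rpow_quarter`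
  — **every window `w(δ) ≥ δ^θ`, `θ < 1/4`, is blocked**; the closed `Prop`
  `SupercriticalSAWSpaceFillingWindowRateQuarter` with `…_holds` (axioms `propext`,
  `Classical.choice`, `Quot.sound`) and `….windowRate` (it contains the gen-15 entry).

So the window clause of the catalogue now reads: blocked for `w(δ) ≥ δ^θ`, `θ < 1/4` (theorem);
equivalent to the sub-problem for `0 ≤ w(δ) = O(δ²)` (theorem, part A); undecided for
`δ² ≪ w(δ) ≲ δ^{1/4}`, the conjectural crossover being `δ^{4/3}` [LSW04, Prediction 2]. The next
lever (`θ < 1/3`) is the squared depth condition `δ ≤ (3N)⁻²` of `isDeep_holeBox` behind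
`meshThreshold_le`, geometrically linear. No planner-facing conclusion changes. Outcome of the
audit as a whole: **CONFIRMED and STRENGTHENED on the window axis at both edges**.

## References

* H. Duminil-Copin, G. Kozma, A. Yadin, Ann. IHP Probab. Stat. 50 (2014) 315–326,
  arXiv:1110.3074: p. 2 (Theorem 1), p. 4 (Lemma 5, Proposition 3), p. 6 (Theorem 6,
  Proposition 7), p. 7 (proof of Theorem 1: hole cardinality `s`, `≥ s/(2m+1)²` boxes), p. 8
  (Problems 9–10, Conjecture 11). [DuminilCopinKozmaYadin2014]
* G. F. Lawler, O. Schramm, W. Werner, *On the scaling limit of planar self-avoiding walk*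
  (2004), Prediction 2 (`ν = 3/4`). [LawlerSchrammWerner2004SAW]

Mathlib: `Nat.lt_floor_add_one`, `pow_lt_pow_left₀`, `Nat.div_lt_of_lt_mul`, `Nat.div_add_mod`,
`Set.le_ncard_of_inj_on_range`, `SimpleGraph.induce_adj`, `Real.rpow_add`, `tendsto_rpow_atTop`,
`tendsto_rpow_neg_atTop`, `tendsto_inv_nhdsGT_zero`.
-/

noncomputable section

open MeasureTheory Filter Topology Metric Set Literature.Probability.LatticeModels
  Literature.Probability.Percolation Literature.Probability.RandomPlanarGeometry
  Literature.Probability.RandomPlanarGeometry.SAW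
open scoped ENNReal NNReal

namespace Literature.Barriers.CriticalPhenomena

namespace SupercriticalSAW

/-! ### The digital square inside an avoided ball -/

section Lattice

/-- The digital square of sites `[z/δ] + (i, j)`, `i, j ∈ ℕ`, based at the nearest site to `z`.
[folklore] -/
def sqSite (δ : ℝ) (z : ℂ) (i j : ℕ) : Site 2 :=
  nearestSite δ z + Pi.single 0 (i : ℤ) + Pi.single 1 (j : ℤ)

/-- Horizontal neighbours of the square are adjacent in `ℤ²`. [folklore] -/
theorem zdGraph_adj_sqSite_succ_left (δ : ℝ) (z : ℂ) (i j : ℕ) :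
    (zdGraph 2).Adj (sqSite δ z i j) (sqSite δ z (i + 1) j) := by
  refine (zdGraph_adj_iff _ _).2 ⟨0, Or.inl ?_⟩
  simp only [sqSite, Nat.cast_add, Nat.cast_one, Pi.single_add]
  abel

/-- Vertical neighbours of the square are adjacent in `ℤ²`. [folklore] -/
theorem zdGraph_adj_sqSite_succ_right (δ : ℝ) (z : ℂ) (i j : ℕ) :
    (zdGraph 2).Adj (sqSite δ z i j) (sqSite δ z i (j + 1)) := by
  refine (zdGraph_adj_iff _ _).2 ⟨1, Or.inl ?_⟩
  simp only [sqSite, Nat.cast_add, Nat.cast_one, Pi.single_add]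
  abel

/-- The square is injectively indexed. [folklore] -/
theorem sqSite_inj {δ : ℝ} {z : ℂ} {i j i' j' : ℕ} (h : sqSite δ z i j = sqSite δ z i' j') :
    i = i' ∧ j = j' := by
  have h0 := congrFun h 0
  have h1 := congrFun h 1
  simp only [sqSite, Pi.add_apply, Pi.single_eq_same,
    Pi.single_eq_of_ne (show (0 : Fin 2) ≠ 1 by decide),
    Pi.single_eq_of_ne (show (1 : Fin 2) ≠ 0 by decide), add_zero, add_right_inj, Nat.cast_inj] at h0 h1
  exact ⟨h0, h1⟩

/-- The `(i, j)`-th site of the square has its mesh point within `δ i + δ j` of that of the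
nearest site to `z` (`δ ≥ 0`). [folklore] -/
theorem dist_meshPoint_sqSite_le {δ : ℝ} (hδ : 0 ≤ δ) (z : ℂ) (i j : ℕ) :
    dist (meshPoint δ (sqSite δ z i j)) (meshPoint δ (nearestSite δ z)) ≤ δ * i + δ * j := by
  rw [Complex.dist_eq]
  have h : meshPoint δ (sqSite δ z i j) - meshPoint δ (nearestSite δ z) =
      ((δ * i : ℝ) : ℂ) + ((δ * j : ℝ) : ℂ) * Complex.I := by
    apply Complex.ext
    · simp only [Complex.sub_re, meshPoint_re, sqSite, Pi.add_apply, Pi.single_eq_same,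
        Pi.single_eq_of_ne (show (0 : Fin 2) ≠ 1 by decide), Int.cast_add, Int.cast_natCast,
        add_zero, Complex.add_re, Complex.ofReal_re, Complex.mul_re, Complex.I_re,
        mul_zero, Complex.ofReal_im, Complex.I_im]
      ring
    · simp only [Complex.sub_im, meshPoint_im, sqSite, Pi.add_apply,
        Pi.single_eq_of_ne (show (1 : Fin 2) ≠ 0 by decide), Pi.single_eq_same, Int.cast_add,
        Int.cast_natCast, add_zero, Complex.add_im, Complex.ofReal_im, Complex.mul_im,
        Complex.ofReal_re, Complex.I_im, mul_one, Complex.I_re, mul_zero, zero_add]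
      ring
  rw [h]
  calc ‖((δ * i : ℝ) : ℂ) + ((δ * j : ℝ) : ℂ) * Complex.I‖
      ≤ ‖((δ * i : ℝ) : ℂ)‖ + ‖((δ * j : ℝ) : ℂ) * Complex.I‖ := norm_add_le _ _
    _ = δ * i + δ * j := by
        rw [norm_mul, Complex.norm_I, mul_one, Complex.norm_real, Complex.norm_real,
          Real.norm_eq_abs, Real.norm_eq_abs, abs_of_nonneg (by positivity),
          abs_of_nonneg (by positivity)]

/-- For `i, j ≤ ⌊r/(6δ)⌋` and `8δ ≤ r` the `(i, j)`-th site of the square has its mesh point in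
`B(z, r/2)` (indeed within `r/3 + δ ≤ 11r/24` of `z`). [folklore] -/
theorem dist_meshPoint_sqSite_lt {δ r : ℝ} (hδ : 0 < δ) (hδr : 8 * δ ≤ r) (z : ℂ) {i j : ℕ}
    (hi : i ≤ ⌊r / (6 * δ)⌋₊) (hj : j ≤ ⌊r / (6 * δ)⌋₊) :
    dist (meshPoint δ (sqSite δ z i j)) z < r / 2 := by
  have hr : 0 < r := by linarith
  have key : ∀ k : ℕ, k ≤ ⌊r / (6 * δ)⌋₊ → δ * k ≤ r / 6 := fun k hk => by
    have hk' : (k : ℝ) ≤ r / (6 * δ) := (Nat.cast_le.2 hk).trans (Nat.floor_le (by positivity))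
    calc δ * k ≤ δ * (r / (6 * δ)) := mul_le_mul_of_nonneg_left hk' hδ.le
      _ = r / 6 := by field_simp
  calc dist (meshPoint δ (sqSite δ z i j)) z
      ≤ dist (meshPoint δ (sqSite δ z i j)) (meshPoint δ (nearestSite δ z)) +
          dist (meshPoint δ (nearestSite δ z)) z := dist_triangle _ _ _
    _ ≤ (δ * i + δ * j) + δ := add_le_add (dist_meshPoint_sqSite_le hδ.le z i j)
        (dist_meshPoint_nearestSite_le hδ z)
    _ < r / 2 := by linarith [key i hi, key j hj]

/-- **An unvisited macroscopic ball is a hole of `≍ (r/δ)²` sites** (the quadratic count; compare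
the digital segment of `≍ r/δ` sites of `hasLargeHole_of_forall_notMem_ball`, `…Refutation`).
Let `γ` be a SAW of `𝔻_δ` starting at a site of `𝔻_δ` and visiting no mesh point of the ball
`B(z, r) ⊆ 𝔻`, with `8δ ≤ r` and `δξ ≤ r/2`. Then the `(⌊r/(6δ)⌋ + 1)²` sites `[z/δ] + (i, j)`,
`0 ≤ i, j ≤ ⌊r/(6δ)⌋`, lie in `𝔻_δ` (their mesh points are in `B(z, r/2) ⊆ 𝔻`), outside the tube
`Γ_δ^ξ` (a site of `𝔻_δ` at graph distance `< ξ` from a visited site is within `δξ ≤ r/2` of a mesh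
point outside `B(z, r)`), and neighbouring ones are adjacent in `𝔻_δ ∖ Γ_δ^ξ`; so some component
of the hole graph has more than `s` sites as soon as `s < (⌊r/(6δ)⌋ + 1)²` — the printed Peierls
bound being in the site-cardinality of the hole ("connected set `S` of cardinality `s`").
[cite: DuminilCopinKozmaYadin2014, §3 (proof of Theorem 1)] -/
theorem hasLargeHole_sq_of_forall_notMem_ball {δ ξ r s : ℝ} {z : ℂ} {a b : Site 2}
    (hδ : 0 < δ) (hball : ball z r ⊆ unitDisk) (hδr : 8 * δ ≤ r) (hξ : δ * ξ ≤ r / 2)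
    (ha : a ∈ meshDomain unitDisk δ) (hs : s < (((⌊r / (6 * δ)⌋₊ : ℕ) : ℝ) + 1) ^ 2)
    (γ : DomainSAW unitDisk δ a b) (hγ : ∀ v ∈ γ.walk.support, meshPoint δ v ∉ ball z r) :
    HasLargeHole ξ s γ := by
  set N : ℕ := ⌊r / (6 * δ)⌋₊ with hN
  -- the sites of the square, `i, j ≤ N`, are vertices of the hole graph
  have hmemD : ∀ i j, i ≤ N → j ≤ N → sqSite δ z i j ∈ meshDomain unitDisk δ := fun i j hi hj => by
    rw [mem_meshDomain_unitDisk, ← mem_ball_zero_iff]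
    exact hball (mem_ball.2 ((dist_meshPoint_sqSite_lt hδ hδr z hi hj).trans_le (by linarith)))
  have hnot : ∀ i j, i ≤ N → j ≤ N → sqSite δ z i j ∉ tube ξ γ := by
    rintro i j hi hj ⟨-, u, hu, hdist⟩
    have huD : u ∈ meshDomain unitDisk δ := walk_support_subset_meshDomain γ.walk ha u hu
    have hreach := reachable_discreteDomainGraph_unitDisk huD (hmemD i j hi hj)
    have h1 := dist_meshPoint_le_mul_graphDist hδ.le hreach
    have h2 : δ * ((discreteDomainGraph unitDisk δ).dist u (sqSite δ z i j) : ℝ) < δ * ξ :=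
      mul_lt_mul_of_pos_left hdist hδ
    have h3 : r ≤ dist (meshPoint δ u) z := by
      by_contra hlt
      exact hγ u hu (mem_ball.2 (not_le.1 hlt))
    have h4 := dist_meshPoint_sqSite_lt hδ hδr z hi hj
    have h5 := dist_triangle (meshPoint δ u) (meshPoint δ (sqSite δ z i j)) z
    linarith
  have hmem : ∀ i j, i ≤ N → j ≤ N → sqSite δ z i j ∈ meshDomain unitDisk δ \ tube ξ γ :=
    fun i j hi hj => ⟨hmemD i j hi hj, hnot i j hi hj⟩
  -- the vertices, as elements of the vertex type of the hole graph
  let g : ℕ → ℕ → ↥(meshDomain unitDisk δ \ tube ξ γ) := fun i j =>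
    if h : i ≤ N ∧ j ≤ N then ⟨sqSite δ z i j, hmem i j h.1 h.2⟩
    else ⟨sqSite δ z 0 0, hmem 0 0 (Nat.zero_le _) (Nat.zero_le _)⟩
  have hg : ∀ i j, i ≤ N → j ≤ N → (g i j : Site 2) = sqSite δ z i j := fun i j hi hj => by
    simp only [g, dif_pos (And.intro hi hj)]
  -- neighbours are adjacent in the hole graph
  have hadjL : ∀ i j, i + 1 ≤ N → j ≤ N → (holeGraph ξ γ).Adj (g i j) (g (i + 1) j) :=
    fun i j hi hj => by
    refine SimpleGraph.induce_adj.2 ?_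
    rw [hg i j (by omega) hj, hg (i + 1) j hi hj]
    exact discreteDomainGraph_unitDisk_adj.2
      ⟨zdGraph_adj_sqSite_succ_left δ z i j, hmemD i j (by omega) hj, hmemD (i + 1) j hi hj⟩
  have hadjR : ∀ i j, i ≤ N → j + 1 ≤ N → (holeGraph ξ γ).Adj (g i j) (g i (j + 1)) :=
    fun i j hi hj => by
    refine SimpleGraph.induce_adj.2 ?_
    rw [hg i j hi (by omega), hg i (j + 1) hi hj]
    exact discreteDomainGraph_unitDisk_adj.2
      ⟨zdGraph_adj_sqSite_succ_right δ z i j, hmemD i j hi (by omega), hmemD i (j + 1) hi hj⟩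
  -- so all lie in the component of `g 0 0`
  have hreachL : ∀ i, i ≤ N → (holeGraph ξ γ).Reachable (g 0 0) (g i 0) := by
    intro i
    induction i with
    | zero => exact fun _ => SimpleGraph.Reachable.refl _
    | succ i ih => exact fun hi => (ih (by omega)).trans (hadjL i 0 hi (Nat.zero_le _)).reachable
  have hreach : ∀ i j, i ≤ N → j ≤ N → (holeGraph ξ γ).Reachable (g 0 0) (g i j) := by
    intro i j hi
    induction j with
    | zero => exact fun _ => hreachL i hi
    | succ j ih => exact fun hj => (ih (by omega)).trans (hadjR i j hi hj).reachable
  set C : (holeGraph ξ γ).ConnectedComponent := (holeGraph ξ γ).connectedComponentMk (g 0 0) with hC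
  -- flatten the index: `k ↦ (k / (N+1), k % (N+1))`, `k < (N+1)²`
  let f : ℕ → ↥(meshDomain unitDisk δ \ tube ξ γ) := fun k => g (k / (N + 1)) (k % (N + 1))
  have hdiv : ∀ k < (N + 1) ^ 2, k / (N + 1) ≤ N := fun k hk => by
    have : k / (N + 1) < N + 1 := Nat.div_lt_of_lt_mul (by simpa [sq] using hk)
    omega
  have hmod : ∀ k, k % (N + 1) ≤ N := fun k => Nat.lt_succ_iff.1 (Nat.mod_lt _ (Nat.succ_pos _))
  have hsupp : ∀ k < (N + 1) ^ 2, f k ∈ C.supp := fun k hk => by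
    rw [SimpleGraph.ConnectedComponent.mem_supp_iff, hC]
    exact SimpleGraph.ConnectedComponent.sound (hreach _ _ (hdiv k hk) (hmod k)).symm
  -- the vertex type of the hole graph is finite, so the support has at least `(N+1)²` elements
  haveI : Finite ↥(meshDomain unitDisk δ \ tube ξ γ) :=
    ((meshDomain_unitDisk_finite hδ).subset sdiff_subset).to_subtype
  have hinj : ∀ k < (N + 1) ^ 2, ∀ k' < (N + 1) ^ 2, f k = f k' → k = k' := fun k hk k' hk' hkk => by
    have h := congrArg (fun v : ↥(meshDomain unitDisk δ \ tube ξ γ) => (v : Site 2)) hkk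
    simp only [f, hg _ _ (hdiv k hk) (hmod k), hg _ _ (hdiv k' hk') (hmod k')] at h
    obtain ⟨h1, h2⟩ := sqSite_inj h
    rw [← Nat.div_add_mod k (N + 1), ← Nat.div_add_mod k' (N + 1), h1, h2]
  have hcard : (N + 1) ^ 2 ≤ C.supp.ncard := Set.le_ncard_of_inj_on_range f hsupp hinj (toFinite _)
  refine ⟨C, hs.trans_le ?_⟩
  exact_mod_cast hcard

end Lattice

/-! ### The effective schedule theorem at QUADRATIC hole size -/

section ScheduleSq

/-- **Space-filling along a fugacity schedule with certified box scales — quadratic form.** As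
`isSpaceFillingLaws_of_Zbox_schedule` of `…StepsNarrow`, but the Peierls bound is required at hole
size `(r/δ)²` instead of `r/δ`: `(prefConst/δ²) e^{-rateConst · (r/δ)²} → 0` for every `r > 0`
(the avoided ball `B(z, r)` being a hole of `≥ (r/(6δ))²` sites,
`hasLargeHole_sq_of_forall_notMem_ball`). [cite: DuminilCopinKozmaYadin2014, Theorem 1 and Theorem 6] -/
theorem isSpaceFillingLaws_of_Zbox_schedule_sq {X : ℝ → ℝ} {M : ℝ → ℕ} {a b : ℂ} (ha : ‖a‖ = 1)
    (hb : ‖b‖ = 1) (hab : a ≠ b) {A B : ℝ → Site 2}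
    (hAB : ∀ δ : ℝ, 0 < δ → IsClosestSite unitDisk δ a (A δ) ∧ IsClosestSite unitDisk δ b (B δ))
    (hX : ∀ᶠ δ in 𝓝[>] (0 : ℝ),
      0 < X δ ∧ 1600 ≤ X δ ^ 18 * Zbox (M δ) (X δ) ∧ δ < meshThreshold (M δ) (X δ) a b)
    (hξ : Tendsto (fun δ : ℝ => (xiP (M δ) 4 : ℝ) * δ) (𝓝[>] 0) (𝓝 0))
    (hrate : ∀ r : ℝ, 0 < r → Tendsto (fun δ : ℝ => prefConst (M δ) (X δ) / δ ^ 2 *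
        Real.exp (-(rateConst (M δ) (X δ) * (r / δ) ^ 2))) (𝓝[>] 0) (𝓝 0)) :
    IsSpaceFillingLaws unitDisk A B fun δ => lawAt (X δ) unitDisk δ (A δ) (B δ) := by
  intro U hU hUΩ hUne
  obtain ⟨z, hz⟩ := hUne
  obtain ⟨r, hr, hzr⟩ := Metric.isOpen_iff.1 hU z hz
  have hsmall : ∀ᶠ δ in 𝓝[>] (0 : ℝ), δ ∈ Set.Ioo 0 (r / 8) := Ioo_mem_nhdsGT (by positivity)
  have hξev : ∀ᶠ δ in 𝓝[>] (0 : ℝ), (xiP (M δ) 4 : ℝ) * δ < r / 2 :=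
    hξ.eventually (Iio_mem_nhds (by positivity : (0 : ℝ) < r / 2))
  have hev : ∀ᶠ δ in 𝓝[>] (0 : ℝ),
      lawAt (X δ) unitDisk δ (A δ) (B δ) {γ | ∀ v ∈ γ.walk.support, meshPoint δ v ∉ U} ≤
        ENNReal.ofReal (prefConst (M δ) (X δ) / δ ^ 2 *
          Real.exp (-(rateConst (M δ) (X δ) * (r / 6 / δ) ^ 2))) := by
    filter_upwards [hX, hsmall, hξev] with δ hXδ hδ hξδ
    obtain ⟨hx, hm, hδlt⟩ := hXδ
    have hδ0 : 0 < δ := hδ.1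
    have hδ8 : 8 * δ ≤ r := by have := hδ.2.le; linarith
    have hδξ : δ * (xiP (M δ) 4 : ℝ) ≤ r / 2 := by rw [mul_comm]; exact hξδ.le
    have hs : (r / 6 / δ) ^ 2 < (((⌊r / (6 * δ)⌋₊ : ℕ) : ℝ) + 1) ^ 2 := by
      rw [div_div]
      exact pow_lt_pow_left₀ (Nat.lt_floor_add_one _) (by positivity) two_ne_zero
    have hspos : 0 < (r / 6 / δ) ^ 2 := by positivity
    calc lawAt (X δ) unitDisk δ (A δ) (B δ) {γ | ∀ v ∈ γ.walk.support, meshPoint δ v ∉ U}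
        ≤ lawAt (X δ) unitDisk δ (A δ) (B δ)
            {γ | HasLargeHole (xiP (M δ) 4 : ℝ) ((r / 6 / δ) ^ 2) γ} :=
          measure_mono fun γ hγ => hasLargeHole_sq_of_forall_notMem_ball hδ0 (hzr.trans hUΩ) hδ8 hδξ
            (hAB δ hδ0).1.1 hs γ (fun v hv hvz => hγ v hv (hzr hvz))
      _ ≤ _ := DKY2014_thm6_disk_effective hx hm ha hb hab hδ0 hδlt (hAB δ hδ0).1 (hAB δ hδ0).2 hspos
  have hupper : Tendsto (fun δ : ℝ => ENNReal.ofReal (prefConst (M δ) (X δ) / δ ^ 2 *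
      Real.exp (-(rateConst (M δ) (X δ) * (r / 6 / δ) ^ 2)))) (𝓝[>] 0) (𝓝 0) := by
    have := ENNReal.tendsto_ofReal (hrate (r / 6) (by positivity))
    rwa [ENNReal.ofReal_zero] at this
  exact tendsto_of_tendsto_of_tendsto_of_le_of_le' tendsto_const_nhds hupper
    (Eventually.of_forall fun δ => zero_le) hev

/-- **No SLE_{8/3} along a fugacity schedule with certified box scales — quadratic form**
(unconditional; the hypotheses of `isSpaceFillingLaws_of_Zbox_schedule_sq` for `(𝔻; 1, -1)`).
[cite: DuminilCopinKozmaYadin2014, Theorem 1 and Conjecture 11] -/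
theorem not_sawScalingLimitAlong_of_Zbox_schedule_sq {X : ℝ → ℝ} {M : ℝ → ℕ}
    (hX : ∀ᶠ δ in 𝓝[>] (0 : ℝ),
      0 < X δ ∧ 1600 ≤ X δ ^ 18 * Zbox (M δ) (X δ) ∧ δ < meshThreshold (M δ) (X δ) 1 (-1))
    (hξ : Tendsto (fun δ : ℝ => (xiP (M δ) 4 : ℝ) * δ) (𝓝[>] 0) (𝓝 0))
    (hrate : ∀ r : ℝ, 0 < r → Tendsto (fun δ : ℝ => prefConst (M δ) (X δ) / δ ^ 2 *
        Real.exp (-(rateConst (M δ) (X δ) * (r / δ) ^ 2))) (𝓝[>] 0) (𝓝 0)) :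
    ¬ SAWScalingLimitAlong X := by
  obtain ⟨A, hA⟩ := exists_closestSiteFamily (1 : ℂ)
  obtain ⟨B, hB⟩ := exists_closestSiteFamily (-1 : ℂ)
  have hAB : ∀ δ : ℝ, 0 < δ →
      IsClosestSite unitDisk δ 1 (A δ) ∧ IsClosestSite unitDisk δ (-1) (B δ) :=
    fun δ hδ => ⟨hA δ hδ, hB δ hδ⟩
  have hne : (1 : ℂ) ≠ -1 := fun h => by
    have h' := congrArg Complex.re h
    norm_num at h'
  exact not_sawScalingLimitAlong_of_isSpaceFillingLaws (D := DobrushinDomain.unitDisc)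
    (isEndpointApprox_unitDisc_of_isClosestSite hAB)
    (isSpaceFillingLaws_of_Zbox_schedule_sq (a := 1) (b := -1) norm_one (by simp) hne hAB hX hξ hrate)
    (fun _ hΓ => hΓ.exists_ball_measure_disjoint_ne_zero sle_restriction_eightThirds_holds
      ae_isSimpleTrace_sleTrace_of_le_four_holds)
    isProjectiveLimit_preWienerMeasure_holds

/-- A window is refuted by one certified schedule inside it (quadratic form).
[cite: DuminilCopinKozmaYadin2014, Theorem 1] -/
theorem not_windowRobustSAWScalingLimit_of_Zbox_schedule_sq {w X : ℝ → ℝ} {M : ℝ → ℕ}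
    (hw : ∀ᶠ δ in 𝓝[>] (0 : ℝ), |X δ - criticalFugacity| ≤ w δ)
    (hX : ∀ᶠ δ in 𝓝[>] (0 : ℝ),
      0 < X δ ∧ 1600 ≤ X δ ^ 18 * Zbox (M δ) (X δ) ∧ δ < meshThreshold (M δ) (X δ) 1 (-1))
    (hξ : Tendsto (fun δ : ℝ => (xiP (M δ) 4 : ℝ) * δ) (𝓝[>] 0) (𝓝 0))
    (hrate : ∀ r : ℝ, 0 < r → Tendsto (fun δ : ℝ => prefConst (M δ) (X δ) / δ ^ 2 *
        Real.exp (-(rateConst (M δ) (X δ) * (r / δ) ^ 2))) (𝓝[>] 0) (𝓝 0)) :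
    ¬ WindowRobustSAWScalingLimit w :=
  fun h => not_sawScalingLimitAlong_of_Zbox_schedule_sq hX hξ hrate (h X hw)

end ScheduleSq

/-! ### The schedule `x(δ) = x_c + δ^θ` for `θ < 1/4` -/

section Schedule

variable {θ C : ℝ} {mOf : ℝ → ℕ}

/-- **The schedule `x(δ) = x_c + δ^θ`, `0 < θ < 1/4`, carries certified scales satisfying the
hypotheses of the quadratic schedule theorem**: the criterion and the mesh threshold eventually
(`4θ < 1`), shrinking tubes (`2θ < 1`), and a vanishing Peierls bound at every macroscopic hole,
now of `(r/δ)²` sites: `exp(2 log s + 200 A s^{2θ} - (r²/(1600 A²)) s^{2-4θ}) → 0` iff `6θ < 2`, so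
the binding constraint is the mesh threshold `θ < 1/4` (the pointwise bound is `schedule_pointwise`
of `…WindowRate` at the `δ`-dependent hole size `r²/δ`). [cite: DuminilCopinKozmaYadin2014, Theorem 6 and Proposition 3] -/
theorem schedule_hypotheses_sq (hθ0 : 0 < θ) (hθ : θ < 1 / 4) (hC : 0 < C)
    (hmOf : ∀ η : ℝ, 0 < η → η ≤ 1 → (mOf η : ℝ) ≤ C / η ^ 2 ∧
      1600 ≤ (criticalFugacity + η) ^ 18 * Zbox (mOf η) (criticalFugacity + η)) :
    (∀ᶠ δ in 𝓝[>] (0 : ℝ), 0 < criticalFugacity + δ ^ θ ∧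
        1600 ≤ (criticalFugacity + δ ^ θ) ^ 18 * Zbox (mOf (δ ^ θ)) (criticalFugacity + δ ^ θ) ∧
        δ < meshThreshold (mOf (δ ^ θ)) (criticalFugacity + δ ^ θ) 1 (-1)) ∧
    Tendsto (fun δ : ℝ => ((xiP (mOf (δ ^ θ)) 4 : ℕ) : ℝ) * δ) (𝓝[>] 0) (𝓝 0) ∧
    (∀ r : ℝ, 0 < r → Tendsto (fun δ : ℝ => prefConst (mOf (δ ^ θ)) (criticalFugacity + δ ^ θ) / δ ^ 2 *
        Real.exp (-(rateConst (mOf (δ ^ θ)) (criticalFugacity + δ ^ θ) * (r / δ) ^ 2)))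
        (𝓝[>] 0) (𝓝 0)) := by
  have hA0 : 0 < C + 15 := by linarith
  have hxc := criticalFugacity_pos_lt_one'.1
  -- the basic eventual conditions: `0 < δ < 1`, `δ^θ ≤ 1/2`
  have hIoo : ∀ᶠ δ in 𝓝[>] (0 : ℝ), δ ∈ Set.Ioo 0 1 := Ioo_mem_nhdsGT one_pos
  have hrpow0 : Tendsto (fun δ : ℝ => δ ^ θ) (𝓝[>] 0) (𝓝 0) := by
    have hc := (Real.continuousAt_rpow_const 0 θ (Or.inr hθ0.le)).tendsto
    rw [Real.zero_rpow hθ0.ne'] at hc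
    exact hc.mono_left nhdsWithin_le_nhds
  have hhalf : ∀ᶠ δ in 𝓝[>] (0 : ℝ), δ ^ θ ≤ 1 / 2 :=
    (hrpow0.eventually (Iic_mem_nhds (by norm_num : (0 : ℝ) < 1 / 2)))
  have hinv : Tendsto (fun δ : ℝ => δ⁻¹) (𝓝[>] 0) atTop := tendsto_inv_nhdsGT_zero
  refine ⟨?_, ?_, fun r hr => ?_⟩
  · -- criterion and mesh threshold: need `6000 A² < s^{1-4θ}` eventually
    have hbig : ∀ᶠ δ in 𝓝[>] (0 : ℝ), 6000 * (C + 15) ^ 2 + 1 ≤ (δ⁻¹) ^ (1 - 4 * θ) :=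
      hinv.eventually ((tendsto_rpow_atTop (by linarith)).eventually_ge_atTop _)
    filter_upwards [hIoo, hhalf, hbig] with δ hδ hδθ hδbig
    obtain ⟨hcrit, -, hmesh, -, -⟩ := schedule_pointwise hθ0 hC hmOf hδ.1 hδ.2 hδθ le_rfl (r := 0)
    refine ⟨by have := Real.rpow_pos_of_pos hδ.1 θ; linarith, hcrit, lt_of_lt_of_le ?_ hmesh⟩
    have hs0 : 0 < δ⁻¹ := inv_pos.2 hδ.1
    have hs4 : 0 < (δ⁻¹) ^ (4 * θ) := Real.rpow_pos_of_pos hs0 _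
    have e2 : (δ⁻¹) ^ (4 * θ) * (δ⁻¹) ^ (1 - 4 * θ) = δ⁻¹ := by
      rw [← Real.rpow_add hs0, show 4 * θ + (1 - 4 * θ) = (1 : ℝ) by ring, Real.rpow_one]
    have key : 6000 * (C + 15) ^ 2 * (δ⁻¹) ^ (4 * θ) < δ⁻¹ := by
      calc 6000 * (C + 15) ^ 2 * (δ⁻¹) ^ (4 * θ) = (δ⁻¹) ^ (4 * θ) * (6000 * (C + 15) ^ 2) := by ring
        _ < (δ⁻¹) ^ (4 * θ) * (δ⁻¹) ^ (1 - 4 * θ) := mul_lt_mul_of_pos_left (by linarith) hs4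
        _ = δ⁻¹ := e2
    calc δ = 1 / δ⁻¹ := by rw [one_div, inv_inv]
      _ < 1 / (6000 * (C + 15) ^ 2 * (δ⁻¹) ^ (4 * θ)) := one_div_lt_one_div_of_lt (by positivity) key
  · -- tubes: `0 ≤ ξ δ ≤ 28 A s^{2θ - 1} → 0`
    have hup : Tendsto (fun δ : ℝ => 28 * (C + 15) * (δ⁻¹) ^ (2 * θ - 1)) (𝓝[>] 0) (𝓝 0) := by
      have h1 := (tendsto_rpow_neg_atTop (by linarith : 0 < 1 - 2 * θ)).comp hinv
      have h2 := h1.const_mul (28 * (C + 15))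
      rw [mul_zero] at h2
      refine h2.congr' (Eventually.of_forall fun δ => ?_)
      show 28 * (C + 15) * (δ⁻¹) ^ (-(1 - 2 * θ)) = 28 * (C + 15) * (δ⁻¹) ^ (2 * θ - 1)
      rw [neg_sub]
    refine tendsto_of_tendsto_of_tendsto_of_le_of_le' tendsto_const_nhds hup ?_ ?_
    · filter_upwards [hIoo] with δ hδ
      exact mul_nonneg (Nat.cast_nonneg _) hδ.1.le
    · filter_upwards [hIoo, hhalf] with δ hδ hδθ
      exact (schedule_pointwise hθ0 hC hmOf hδ.1 hδ.2 hδθ le_rfl (r := 0)).2.2.2.1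
  · -- the Peierls bound at hole size `(r/δ)² = (r²/δ)/δ`:
    -- squeeze under `exp(2 log s + 200 A s^{2θ} - (r²/(1600A²)) s^{2-4θ}) → 0` (`6θ < 2`)
    have ha : 0 < r ^ 2 / (1600 * (C + 15) ^ 2) := by positivity
    have hup := (tendsto_exp_log_add_rpow_sub_rpow (A := 200 * (C + 15)) ha
      (by linarith : 0 < 2 * θ) (by linarith : 2 * θ < 2 - 4 * θ)).comp hinv
    refine tendsto_of_tendsto_of_tendsto_of_le_of_le' tendsto_const_nhds hup ?_ ?_
    · filter_upwards [hIoo, hhalf] with δ hδ hδθ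
      obtain ⟨hcrit, -⟩ := schedule_pointwise hθ0 hC hmOf hδ.1 hδ.2 hδθ le_rfl (r := 0)
      have hx0 : 0 < criticalFugacity + δ ^ θ := by
        have := Real.rpow_pos_of_pos hδ.1 θ; linarith
      exact mul_nonneg (div_nonneg (prefConst_nonneg hx0 hcrit) (by positivity)) (Real.exp_nonneg _)
    · filter_upwards [hIoo, hhalf] with δ hδ hδθ
      have hδ0 : 0 < δ := hδ.1
      have hr' : 0 ≤ r ^ 2 / δ := by positivity
      have h := (schedule_pointwise hθ0 hC hmOf hδ.1 hδ.2 hδθ hr').2.2.2.2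
      have e1 : r ^ 2 / δ / δ = (r / δ) ^ 2 := by
        rw [div_pow, sq δ, div_div]
      have e2 : r ^ 2 / δ / (1600 * (C + 15) ^ 2) * (δ⁻¹) ^ (1 - 4 * θ) =
          r ^ 2 / (1600 * (C + 15) ^ 2) * (δ⁻¹) ^ (2 - 4 * θ) := by
        have e3 : (δ⁻¹) ^ (2 - 4 * θ) = δ⁻¹ * (δ⁻¹) ^ (1 - 4 * θ) := by
          rw [show (2 - 4 * θ) = 1 + (1 - 4 * θ) by ring, Real.rpow_add (inv_pos.2 hδ0),
            Real.rpow_one]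
        rw [e3, div_div, div_eq_mul_inv (r ^ 2) (δ * _), mul_inv, div_eq_mul_inv (r ^ 2)]
        ring
      rw [e1, e2] at h
      exact h

end Schedule

/-! ### Assembly: every window `w(δ) ≥ δ^θ`, `θ < 1/4`, is blocked -/

/-- **The supercritical schedule `x(δ) = x_c + δ^θ`, `0 < θ < 1/4`, is weakly space-filling in the
unit disc** (closest-site endpoints at `1, -1`). [cite: DuminilCopinKozmaYadin2014, Theorem 1 and Theorem 6] -/
theorem isSpaceFillingLaws_rpow_schedule_quarter {θ : ℝ} (hθ0 : 0 < θ) (hθ : θ < 1 / 4)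
    {A B : ℝ → Site 2}
    (hAB : ∀ δ : ℝ, 0 < δ → IsClosestSite unitDisk δ 1 (A δ) ∧ IsClosestSite unitDisk δ (-1) (B δ)) :
    IsSpaceFillingLaws unitDisk A B fun δ => lawAt (criticalFugacity + δ ^ θ) unitDisk δ (A δ) (B δ) := by
  obtain ⟨C, hC, mOf, hmOf⟩ := exists_certifiedScaleFun
  obtain ⟨hX, hξ, hrate⟩ := schedule_hypotheses_sq hθ0 hθ hC hmOf
  have hne : (1 : ℂ) ≠ -1 := fun h => by
    have h' := congrArg Complex.re h
    norm_num at h'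
  exact isSpaceFillingLaws_of_Zbox_schedule_sq (X := fun δ => criticalFugacity + δ ^ θ)
    (M := fun δ => mOf (δ ^ θ)) (a := 1) (b := -1) norm_one (by simp) hne hAB hX hξ hrate

/-- **No SLE_{8/3} along `x(δ) = x_c + δ^θ` for `0 < θ < 1/4`** (unconditional).
[cite: DuminilCopinKozmaYadin2014, Theorem 1] -/
theorem not_sawScalingLimitAlong_rpow_quarter {θ : ℝ} (hθ0 : 0 < θ) (hθ : θ < 1 / 4) :
    ¬ SAWScalingLimitAlong fun δ => criticalFugacity + δ ^ θ := by
  obtain ⟨C, hC, mOf, hmOf⟩ := exists_certifiedScaleFun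
  obtain ⟨hX, hξ, hrate⟩ := schedule_hypotheses_sq hθ0 hθ hC hmOf
  exact not_sawScalingLimitAlong_of_Zbox_schedule_sq (X := fun δ => criticalFugacity + δ ^ θ)
    (M := fun δ => mOf (δ ^ θ)) hX hξ hrate

/-- **Every fugacity window eventually as wide as `δ^θ`, `θ < 1/4`, is blocked.** This improves
the exponent `1/6` of `not_windowRobustSAWScalingLimit_of_rpow_le` (`…WindowRate`) through the
quadratic hole count alone. [cite: DuminilCopinKozmaYadin2014, Theorem 1 and Proposition 3] -/
theorem not_windowRobustSAWScalingLimit_of_rpow_le_quarter {θ : ℝ} (hθ : θ < 1 / 4) {w : ℝ → ℝ}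
    (hw : ∀ᶠ δ in 𝓝[>] (0 : ℝ), δ ^ θ ≤ w δ) : ¬ WindowRobustSAWScalingLimit w := by
  set θ' : ℝ := max θ (1 / 12) with hθ'
  have hθ'0 : 0 < θ' := lt_of_lt_of_le (by norm_num) (le_max_right _ _)
  have hθ'4 : θ' < 1 / 4 := max_lt hθ (by norm_num)
  obtain ⟨C, hC, mOf, hmOf⟩ := exists_certifiedScaleFun
  obtain ⟨hX, hξ, hrate⟩ := schedule_hypotheses_sq hθ'0 hθ'4 hC hmOf
  refine not_windowRobustSAWScalingLimit_of_Zbox_schedule_sq (X := fun δ => criticalFugacity + δ ^ θ')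
    (M := fun δ => mOf (δ ^ θ')) ?_ hX hξ hrate
  have hIoo : ∀ᶠ δ in 𝓝[>] (0 : ℝ), δ ∈ Set.Ioo 0 1 := Ioo_mem_nhdsGT one_pos
  filter_upwards [hw, hIoo] with δ hwδ hδ
  have h1 : δ ^ θ' ≤ δ ^ θ := Real.rpow_le_rpow_of_exponent_ge hδ.1 hδ.2.le (le_max_left _ _)
  have h0 : 0 ≤ δ ^ θ' := Real.rpow_nonneg hδ.1.le _
  rw [add_sub_cancel_left, abs_of_nonneg h0]
  exact h1.trans hwδ

/-- In particular `¬ WindowRobustSAWScalingLimit (δ ↦ δ^θ)` for every `θ < 1/4`.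
[cite: DuminilCopinKozmaYadin2014, Theorem 1] -/
theorem not_windowRobustSAWScalingLimit_rpow_quarter {θ : ℝ} (hθ : θ < 1 / 4) :
    ¬ WindowRobustSAWScalingLimit fun δ => δ ^ θ :=
  not_windowRobustSAWScalingLimit_of_rpow_le_quarter hθ (Eventually.of_forall fun _ => le_rfl)

end SupercriticalSAW

open SupercriticalSAW

/-- **Barrier `SupercriticalSAWSpaceFillingWindowRateQuarter`** (nineteenth audit of `…Proofs`,
part B, PROVED below): every window-robust strengthening
`SupercriticalSAW.WindowRobustSAWScalingLimit w` of the sub-problem whose window is eventually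
`≥ δ^θ` for some `θ < 1/4` is false — the exponent `1/6` of `SupercriticalSAWSpaceFillingWindowRate`
improved by the quadratic hole count alone.

BARRIER (structured block, D-0021):
- technique_class: polynomially-wide near-critical fugacity windows `w(δ) ≥ δ^θ`, `θ < 1/4` (an SLE_{8/3} CONCLUSION asserted along every schedule inside the window; contains the class `θ < 1/6` of `…WindowRate` and every constant window of `SupercriticalSAWSpaceFilling`) [cite: DuminilCopinKozmaYadin2014, Theorem 1]
- blocks: `WindowRobustSAWScalingLimit w` for every such `w` (`SupercriticalSAW.not_windowRobustSAWScalingLimit_of_rpow_le_quarter`), in particular `WindowRobustSAWScalingLimit (δ ↦ δ^θ)` (`SupercriticalSAW.not_windowRobustSAWScalingLimit_rpow_quarter`) and `SAWScalingLimitAlong (δ ↦ x_c + δ^θ)`, `0 < θ < 1/4` (`SupercriticalSAW.not_sawScalingLimitAlong_rpow_quarter`); positively, the schedule `x_c + δ^θ`, `0 < θ < 1/4`, is weakly space-filling in the disc (`SupercriticalSAW.isSpaceFillingLaws_rpow_schedule_quarter`) — all unconditional (axioms `propext`, `Classical.choice`, `Quot.sound`)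
- because: the printed Peierls estimate is in the site-cardinality `s` of the hole ("connected set `S` of cardinality `s` … there must exist a connected family of at least `s/(2m+1)²` boxes … `≤ C(x,m,Ω) δ⁻² 2^{-s/(2m+1)²}`") [cite: DuminilCopinKozmaYadin2014, §3 (proof of Theorem 1)], and a ball `B(z, r) ⊆ 𝔻` free of visited mesh points contains, for `8δ ≤ r` and `ξδ ≤ r/2`, the digital SQUARE of `(⌊r/(6δ)⌋ + 1)²` sites `[z/δ] + (i, j)` inside one component of `𝔻_δ ∖ Γ_δ^ξ` (`SupercriticalSAW.hasLargeHole_sq_of_forall_notMem_ball`; `…WindowRate` used the digital segment of `⌊r/(4δ)⌋ + 1` sites of `SupercriticalSAW.hasLargeHole_of_forall_notMem_ball`); with the certified scale `m ≤ C/η²` at `x_c + η` (`SupercriticalSAW.exists_certifiedScale_le`) [cite: DuminilCopinKozmaYadin2014, Lemma 5 and Proposition 3] and the constants of the effective Theorem 6 (`SupercriticalSAW.schedule_pointwise`, applied at the hole size `r²/δ`), the bound along `η = δ^θ` is `exp(2 log δ⁻¹ + 200A δ^{-2θ} - (r²/(1600A²)) δ^{4θ-2}) → 0` iff `6θ < 2`,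 while the certified scale is usable only at meshes below the tile construction's threshold `(6000 A² δ^{-4θ})⁻¹`, i.e. iff `4θ < 1` — the binding constraint
- evasions_known: windows `δ^{1/4} ≲ w(δ)` down to the volume windows `O(δ²)` (EQUIVALENT to the sub-problem: `SupercriticalSAW.windowRobustSAWScalingLimit_iff` of `…Narrow` for `o(δ²)`, `SupercriticalSAW.windowRobustSAWScalingLimit_sq_iff` of `…VolumeWindow` for `C δ²`) are decided by no theorem; the predicted crossover is `|x - x_c| ≍ δ^{4/3}` (`ν = 3/4`) [cite: LawlerSchrammWerner2004SAW, Prediction 2]; the next lever is the mesh threshold `δ < (9m+75)⁻²` of the tile construction (`SupercriticalSAW.meshThreshold_le`, from the squared depth condition of `isDeep_holeBox`), geometrically a linear condition `m δ ≲ 1` would do and would give `θ < 1/3`, after which the span/length trade-off of the squared walks (`m ≤ n`, "finding the maximal `m` as an explicit function of `n`, even asymptotically, seems difficult" [cite: DuminilCopinKozmaYadin2014, §2 (proof of Proposition 3)]) and the capped per-box gain are the remaining ones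
- scope_caveats: unit disc, `ℤ²`, closest-site endpoints `1, -1` (any boundary pair `a ≠ b` works), hole-size ⇒ weak space-filling ⇒ no SLE_κ (`κ ≤ 4` inputs of `…StepsNarrow`); the exponent `1/4` and all constants are artefacts of the tree's tile proof, not of the source, whose `m(x)`, `ξ(x) = 6m`, `c(x)` are inexplicit [cite: DuminilCopinKozmaYadin2014, Theorem 1 and Theorem 6]
- status: established (proved in the tree: `SupercriticalSAWSpaceFillingWindowRateQuarter_holds`)

[cite: DuminilCopinKozmaYadin2014, Theorem 1 and Proposition 3] -/
def SupercriticalSAWSpaceFillingWindowRateQuarter : Prop :=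
  ∀ θ : ℝ, θ < 1 / 4 → ∀ w : ℝ → ℝ,
    (∀ᶠ δ in 𝓝[>] (0 : ℝ), δ ^ θ ≤ w δ) → ¬ SupercriticalSAW.WindowRobustSAWScalingLimit w

/-- **The quarter window-rate barrier holds.** [cite: DuminilCopinKozmaYadin2014, Theorem 1 and Proposition 3] -/
theorem SupercriticalSAWSpaceFillingWindowRateQuarter_holds : SupercriticalSAWSpaceFillingWindowRateQuarter :=
  fun _ hθ _ hw => not_windowRobustSAWScalingLimit_of_rpow_le_quarter hθ hw

/-- The quarter entry contains the gen-15 entry (`θ < 1/6 < 1/4`). [cite: DuminilCopinKozmaYadin2014, Theorem 1] -/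
theorem SupercriticalSAWSpaceFillingWindowRateQuarter.windowRate
    (h : SupercriticalSAWSpaceFillingWindowRateQuarter) : SupercriticalSAWSpaceFillingWindowRate :=
  fun θ hθ w hw => h θ (by linarith) w hw

end Literature.Barriers.CriticalPhenomena
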